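import Mathlib
import Summits.ValiantsHypothesis.ValiantsHypothesis.Theorems.NNDivisionHard.Negative.LocatedPencilLawFalsePassenger
import Summits.ValiantsHypothesis.ValiantsHypothesis.Theorems.NNDivisionHard.Negative.LocatedPencilLawFalseSlots

/-!
# The vertex-row certificate of KILL NOTE N22 — the identity (crux `FifoMatching.NNDivisionHard`,
# stmt-ValiantsHypothesis-21181; Negative lane)
val-idea-crit-9 g2 (critic of record, WAVE 6).  Third file of the kernel of N22: for every located `{0,1}`-tilted row
`(a, c)` and column `(b, π)`,
`(1 − |a∩b|)² + Σ_i (max(𝟙_c − 𝟙_a, 0)_i − (𝟙_c − 𝟙_a)_i b_i) + λ·inv(c; π) = Σ_s rowU (a,c) s · colV (b,π) s`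
over the slot set of `…LocatedPencilLawFalseSlots` (`λ = 16n`).  Method: every family sum is computed in the atoms
`S1 s = Σ 𝟙_s`, `S2 s t = Σ 𝟙_s 𝟙_t`, `S3 s t u = Σ 𝟙_s 𝟙_t 𝟙_u` and `inv c π`; the only relations used are `S1 c = |c|`,
`S2 a c = |a∩c|`, `S1 P_{|c|}(π) = |c|`; the rest is `ring`.  Exact rational machine check at `n = 3, 4` preceded the typing.
Theorems only; VP ≠ VNP is NOT proved; the crux stays OPEN.
-/

namespace Summit.ValiantsHypothesis.Theorems.NNDivisionHardNegative.LocatedPencil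

open Matrix Finset
open Summit.ValiantsHypothesis.ValiantsHypothesis.Theorems.FifoMatching.XcDivision (udInd udInd_apply udInd_sq udInd_inter)
open Summit.ValiantsHypothesis.Theorems.NNDivisionHardNegative.DiagTilted (udInd_compl)
open Summit.ValiantsHypothesis.Theorems.NNDivisionHardNegative.CliqueRowBlind (sum_udInd_univ)

noncomputable section

variable {n : ℕ}

/-! ## §1 Atoms and generic sums -/

/-- `S1 s = Σ_i 𝟙_s(i)` (`= |s|`). -/
def S1 (s : Finset (Fin n)) : ℝ := ∑ i, udInd s i

/-- `S2 s t = Σ_i 𝟙_s(i) 𝟙_t(i)` (`= |s ∩ t|`). -/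
def S2 (s t : Finset (Fin n)) : ℝ := ∑ i, udInd s i * udInd t i

/-- `S3 s t u = Σ_i 𝟙_s(i) 𝟙_t(i) 𝟙_u(i)`. -/
def S3 (s t u : Finset (Fin n)) : ℝ := ∑ i, udInd s i * udInd t i * udInd u i

/-- `Σ_{i ∈ s} F = Σ_i 𝟙_s(i) F(i)`. -/
theorem sum_mem_udInd (s : Finset (Fin n)) (F : Fin n → ℝ) : ∑ i ∈ s, F i = ∑ i, udInd s i * F i := by
  have : ∀ i, udInd s i * F i = if i ∈ s then F i else 0 := fun i => by
    rw [udInd_apply]; split_ifs <;> simp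
  simp only [this]
  rw [Finset.sum_ite_mem, Finset.univ_inter]

/-- `Σ_i Σ_{m ≠ i} f_i g_m = (Σ f)(Σ g) − Σ f_i g_i`. -/
theorem sum_mul_sum_ne (f g : Fin n → ℝ) :
    ∑ i, ∑ m, (if i = m then 0 else f i * g m) = (∑ i, f i) * (∑ m, g m) - ∑ i, f i * g i := by
  rw [Finset.sum_mul_sum, ← Finset.sum_sub_distrib]
  refine Finset.sum_congr rfl fun i _ => ?_
  have : ∀ m, (if i = m then (0 : ℝ) else f i * g m) = f i * g m - if i = m then f i * g m else 0 := by
    intro m; split_ifs <;> ring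
  simp only [this, Finset.sum_sub_distrib, Finset.sum_ite_eq, Finset.mem_univ, if_true]

/-- selecting the block `k = m` in a sum over `Fin (n+1)`. -/
theorem sum_fin_sel {m : ℕ} (hm : m ≤ n) (f : Fin (n + 1) → ℝ) :
    ∑ k : Fin (n + 1), (if (k : ℕ) = m then 1 else 0) * f k = f ⟨m, Nat.lt_succ_of_le hm⟩ := by
  rw [Finset.sum_eq_single ⟨m, Nat.lt_succ_of_le hm⟩]
  · simp
  · intro k _ hk
    have : (k : ℕ) ≠ m := fun h => hk (Fin.ext h)
    rw [if_neg this, zero_mul]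
  · intro h; exact absurd (Finset.mem_univ _) h

/-- `|P_k(π)| = k` for `k ≤ n`, as `S1`. -/
theorem S1_Pset {k : ℕ} (hk : k ≤ n) (π : Equiv.Perm (Fin n)) : S1 (Pset k π) = k := by
  unfold S1
  have h1 : ∀ i, udInd (Pset k π) i = if ((π i : ℕ)) < k then (1 : ℝ) else 0 := fun i => by
    rw [udInd_apply]; simp [Pset]
  simp only [h1]
  rw [Equiv.sum_comp π (fun x : Fin n => if (x : ℕ) < k then (1 : ℝ) else 0)]
  rw [Fin.sum_univ_eq_sum_range (fun x => if x < k then (1 : ℝ) else 0) n, Finset.sum_ite, Finset.sum_const_zero,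
    add_zero, Finset.sum_const, nsmul_eq_mul, mul_one]
  have : (Finset.range n).filter (fun x => x < k) = Finset.range k := by
    ext x; simp only [Finset.mem_filter, Finset.mem_range]; omega
  rw [this, Finset.card_range]

/-- the inversion count as a full double sum of indicators. -/
theorem inv_eq_sum (c : Finset (Fin n)) (π : Equiv.Perm (Fin n)) :
    inv c π = ∑ i, ∑ j, udInd c i * (1 - udInd c j) * (if π j < π i then (1 : ℝ) else 0) := by
  rw [inv, sum_mem_udInd]
  refine Finset.sum_congr rfl fun i _ => ?_
  rw [sum_mem_udInd, Finset.mul_sum]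
  refine Finset.sum_congr rfl fun j _ => ?_
  rw [udInd_compl]; ring

/-! ## §2 Pointwise algebra of indicators -/

/-- `(1 − 𝟙)(1 − 𝟙) = 1 − 𝟙`. -/
theorem one_sub_udInd_sq (s : Finset (Fin n)) (i : Fin n) : (1 - udInd s i) * (1 - udInd s i) = 1 - udInd s i := by
  have := udInd_sq s i
  ring_nf; nlinarith

/-- `max(𝟙_c − 𝟙_a, 0) = 𝟙_c (1 − 𝟙_a)`. -/
theorem max_sub_eq (a c : Finset (Fin n)) (i : Fin n) :
    max (udInd c i - udInd a i) 0 = udInd c i * (1 - udInd a i) := by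
  rw [udInd_apply, udInd_apply]; split_ifs <;> norm_num

/-! ## §3 Family sums -/

section families
variable (a c b : Finset (Fin n)) (π : Equiv.Perm (Fin n))

/-- `pairB`: `x(x−1) + 2xy` with `x = S2 a b − S3 a c b`, `y = S3 a c b`. -/
theorem pairB_sum :
    ∑ p : Fin n × Fin n, rowU a c (Sum.inl p) * colV b π (Sum.inl p)
      = ((S2 a b - S3 a c b) * (S2 a b - S3 a c b) - (S2 a b - S3 a c b)) + 2 * ((S2 a b - S3 a c b) * S3 a c b) := by
  have hx : ∑ i, udInd a i * (1 - udInd c i) * udInd b i = S2 a b - S3 a c b := by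
    rw [S2, S3, ← Finset.sum_sub_distrib]; exact Finset.sum_congr rfl fun i _ => by ring
  have hxx : ∑ i, udInd a i * (1 - udInd c i) * udInd b i * (udInd a i * (1 - udInd c i) * udInd b i)
      = S2 a b - S3 a c b := by
    rw [← hx]; refine Finset.sum_congr rfl fun i _ => ?_
    have ha := udInd_sq a i; have hc := one_sub_udInd_sq c i; have hb := udInd_sq b i
    calc _ = (udInd a i * udInd a i) * ((1 - udInd c i) * (1 - udInd c i)) * (udInd b i * udInd b i) := by ring
      _ = _ := by rw [ha, hc, hb]
  have hsplit : ∀ i m : Fin n, rowU a c (Sum.inl (i, m)) * colV b π (Sum.inl (i, m))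
      = (if i = m then 0 else
          (udInd a i * (1 - udInd c i) * udInd b i) * (udInd a m * (1 - udInd c m) * udInd b m))
        + 2 * ((udInd a i * (1 - udInd c i) * udInd b i) * (udInd a m * udInd c m * udInd b m)) := by
    intro i m; simp only [rowU, colV, Sum.elim_inl]; split_ifs <;> ring
  have hy : ∑ i, udInd a i * udInd c i * udInd b i = S3 a c b := rfl
  rw [Fintype.sum_prod_type]
  simp only [hsplit, Finset.sum_add_distrib, ← Finset.mul_sum]
  rw [sum_mul_sum_ne, ← Finset.sum_mul, hx, hxx, hy]

/-- `E1`: `λ (inv − |c∖P|·|P∖c|)` at `k = |c|`. -/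
theorem e1_sum :
    ∑ q : Fin (n + 1) × Fin n × Fin n, rowU a c (Sum.inr (Sum.inl q)) * colV b π (Sum.inr (Sum.inl q))
      = lam n * (inv c π - (S1 c - S2 c (Pset c.card π)) * (S1 (Pset c.card π) - S2 c (Pset c.card π))) := by
  have hc : c.card ≤ n := (Finset.card_le_univ c).trans (by simp)
  rw [Fintype.sum_prod_type]
  have hk : ∀ k : Fin (n + 1), ∑ p : Fin n × Fin n, rowU a c (Sum.inr (Sum.inl (k, p))) * colV b π (Sum.inr (Sum.inl (k, p)))
      = (if (k : ℕ) = c.card then 1 else 0) * ∑ p : Fin n × Fin n,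
          lam n * (udInd c p.1 * (1 - udInd c p.2)) *
            ((if π p.2 < π p.1 then 1 else 0) - udInd (Pset k π) p.2 * (1 - udInd (Pset k π) p.1)) := by
    intro k; rw [Finset.mul_sum]; refine Finset.sum_congr rfl fun p _ => ?_
    simp only [rowU, colV, Sum.elim_inl, Sum.elim_inr]; ring
  simp only [hk]
  rw [sum_fin_sel hc, Fintype.sum_prod_type]
  have h2 : ∀ i j : Fin n, lam n * (udInd c i * (1 - udInd c j)) *
      ((if π j < π i then 1 else 0) - udInd (Pset c.card π) j * (1 - udInd (Pset c.card π) i))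
      = lam n * (udInd c i * (1 - udInd c j) * (if π j < π i then (1 : ℝ) else 0))
        - lam n * ((udInd c i * (1 - udInd (Pset c.card π) i)) * ((1 - udInd c j) * udInd (Pset c.card π) j)) := by
    intro i j; ring
  simp only [h2, Finset.sum_sub_distrib, ← Finset.mul_sum]
  rw [← inv_eq_sum, ← Finset.sum_mul]
  have h3 : ∑ i, udInd c i * (1 - udInd (Pset c.card π) i) = S1 c - S2 c (Pset c.card π) := by
    rw [S1, S2, ← Finset.sum_sub_distrib]; exact Finset.sum_congr rfl fun i _ => by ring
  have h4 : ∑ i, (1 - udInd c i) * udInd (Pset c.card π) i = S1 (Pset c.card π) - S2 c (Pset c.card π) := by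
    rw [S1, S2, ← Finset.sum_sub_distrib]; exact Finset.sum_congr rfl fun i _ => by ring
  rw [h3, h4]; ring

/-- `E2`: `λ (|P∖c|² − |P∖c|)` at `k = |c|`. -/
theorem e2_sum :
    ∑ q : Fin (n + 1) × Fin n × Fin n, rowU a c (Sum.inr (Sum.inr (Sum.inl q))) * colV b π (Sum.inr (Sum.inr (Sum.inl q)))
      = lam n * ((S1 (Pset c.card π) - S2 c (Pset c.card π)) * (S1 (Pset c.card π) - S2 c (Pset c.card π))
          - (S1 (Pset c.card π) - S2 c (Pset c.card π))) := by
  have hc : c.card ≤ n := (Finset.card_le_univ c).trans (by simp)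
  rw [Fintype.sum_prod_type]
  have hk : ∀ k : Fin (n + 1), ∑ p : Fin n × Fin n,
      rowU a c (Sum.inr (Sum.inr (Sum.inl (k, p)))) * colV b π (Sum.inr (Sum.inr (Sum.inl (k, p))))
      = (if (k : ℕ) = c.card then 1 else 0) * (lam n * ∑ p : Fin n × Fin n,
          (if p.1 = p.2 then 0 else
            ((1 - udInd c p.1) * udInd (Pset k π) p.1) * ((1 - udInd c p.2) * udInd (Pset k π) p.2))) := by
    intro k; rw [Finset.mul_sum, Finset.mul_sum]; refine Finset.sum_congr rfl fun p _ => ?_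
    simp only [rowU, colV, Sum.elim_inl, Sum.elim_inr]; split_ifs <;> ring
  simp only [hk]
  rw [sum_fin_sel hc, Fintype.sum_prod_type]
  dsimp only
  rw [sum_mul_sum_ne]
  have h4 : ∑ i, (1 - udInd c i) * udInd (Pset c.card π) i = S1 (Pset c.card π) - S2 c (Pset c.card π) := by
    rw [S1, S2, ← Finset.sum_sub_distrib]; exact Finset.sum_congr rfl fun i _ => by ring
  have h5 : ∑ i, (1 - udInd c i) * udInd (Pset c.card π) i * ((1 - udInd c i) * udInd (Pset c.card π) i)
      = S1 (Pset c.card π) - S2 c (Pset c.card π) := by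
    rw [← h4]; refine Finset.sum_congr rfl fun i _ => ?_
    have hc' := one_sub_udInd_sq c i; have hP := udInd_sq (Pset c.card π) i
    calc _ = ((1 - udInd c i) * (1 - udInd c i)) * (udInd (Pset c.card π) i * udInd (Pset c.card π) i) := by ring
      _ = _ := by rw [hc', hP]
  rw [h4, h5]

/-! ### the block families at `(k, k') = (|c|, |a∩c|)` -/

/-- selecting the block `(k, k') = (|c|, |a∩c|)`. -/
theorem sum_sel (hc : c.card ≤ n) (hac : (a ∩ c).card ≤ n) (F : Fin (n + 1) → Fin (n + 1) → ℝ) :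
    ∑ k : Fin (n + 1), ∑ k' : Fin (n + 1), sel a c k k' * F k k'
      = F ⟨c.card, Nat.lt_succ_of_le hc⟩ ⟨(a ∩ c).card, Nat.lt_succ_of_le hac⟩ := by
  have h1 : ∀ k : Fin (n + 1), ∑ k' : Fin (n + 1), sel a c k k' * F k k'
      = (if (k : ℕ) = c.card then 1 else 0) * F k ⟨(a ∩ c).card, Nat.lt_succ_of_le hac⟩ := by
    intro k
    by_cases hk : (k : ℕ) = c.card
    · rw [if_pos hk, one_mul]
      have : ∀ k' : Fin (n + 1), sel a c k k' * F k k' = (if (k' : ℕ) = (a ∩ c).card then 1 else 0) * F k k' := by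
        intro k'; unfold sel; rw [hk]; by_cases hk' : (k' : ℕ) = (a ∩ c).card <;> simp [hk']
      simp only [this]
      rw [sum_fin_sel hac (F k)]
    · rw [if_neg hk, zero_mul]
      refine Finset.sum_eq_zero fun k' _ => ?_
      unfold sel; rw [if_neg (fun h => hk h.1), zero_mul]
  simp only [h1]
  rw [sum_fin_sel hc (fun k => F k ⟨(a ∩ c).card, Nat.lt_succ_of_le hac⟩)]

/-- the `Z`-sum: `Σ_r ρ_r κ_r = D_P + (S2 c b − S3 c b P) + τ`. -/
theorem sum_rho_kap (k k' : ℕ) :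
    ∑ r, rho a c r * kap b π k k' r
      = DP b π k k' + (S2 c b - S3 c b (Pset k π)) + (S1 c - S2 a c - S2 c b + S3 a c b) := by
  rw [Fintype.sum_option, Fintype.sum_sum_type]
  simp only [rho, kap, one_mul]
  have h1 : ∑ i, udInd c i * (udInd b i * (1 - udInd (Pset k π) i)) = S2 c b - S3 c b (Pset k π) := by
    rw [S2, S3, ← Finset.sum_sub_distrib]; exact Finset.sum_congr rfl fun i _ => by ring
  have h2 : ∑ j, udInd c j * (1 - udInd a j) * (1 - udInd b j) = S1 c - S2 a c - S2 c b + S3 a c b := by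
    rw [S1, S2, S2, S3, ← Finset.sum_sub_distrib, ← Finset.sum_sub_distrib, ← Finset.sum_add_distrib]
    exact Finset.sum_congr rfl fun i _ => by ring
  rw [h1, h2]; ring

/-- the budget prices: `Σ_r ρ_r β_r = 4n + 2|c| + 2|c∖a|`. -/
theorem sum_rho_beta : ∑ r, rho a c r * beta n r = 4 * n + 2 * S1 c + 2 * (S1 c - S2 a c) := by
  rw [Fintype.sum_option, Fintype.sum_sum_type]
  simp only [rho, beta, one_mul]
  have h1 : ∑ i, udInd c i * 2 = 2 * S1 c := by
    rw [S1, Finset.mul_sum]; exact Finset.sum_congr rfl fun i _ => by ring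
  have h2 : ∑ j, udInd c j * (1 - udInd a j) * 2 = 2 * (S1 c - S2 a c) := by
    rw [S1, S2, ← Finset.sum_sub_distrib, Finset.mul_sum]; exact Finset.sum_congr rfl fun i _ => by ring
  rw [h1, h2]; ring

/-- the block total in the regime `D_P < 0`. -/
theorem blk_sum_neg (k k' : ℕ) (hD : DP b π k k' < 0) :
    ∑ x : BlkIx n, blkU a c k k' x * blkV b π k k' x
      = -DP b π k k' + (S3 a c b * S3 a c b - S3 a c b)
        + ((S2 b (Pset k π) - S3 c b (Pset k π)) + bud n * (S1 (Pset k π) - S2 c (Pset k π)))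
        + (bud n * (S1 c - S2 c (Pset k π)) - (S2 c b - S3 c b (Pset k π))) := by
  simp only [Fintype.sum_sum_type, blkU, blkV, Sum.elim_inl, Sum.elim_inr, if_pos hD, mul_zero,
    Finset.sum_const_zero, add_zero, Fintype.sum_unique, one_mul]
  have hY : ∑ p : Fin n × Fin n, udInd a p.1 * udInd c p.1 * (udInd a p.2 * udInd c p.2) *
      (if p.1 = p.2 then 0 else 1) * (udInd b p.1 * udInd b p.2)
      = S3 a c b * S3 a c b - S3 a c b := by
    have : ∀ i m : Fin n, udInd a i * udInd c i * (udInd a m * udInd c m) *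
        (if i = m then 0 else 1) * (udInd b i * udInd b m)
        = if i = m then 0 else (udInd a i * udInd c i * udInd b i) * (udInd a m * udInd c m * udInd b m) := by
      intro i m; split_ifs <;> ring
    rw [Fintype.sum_prod_type]
    simp only [this]
    rw [sum_mul_sum_ne, S3]
    congr 1
    refine Finset.sum_congr rfl fun i _ => ?_
    have ha := udInd_sq a i; have hc := udInd_sq c i; have hb := udInd_sq b i
    calc _ = (udInd a i * udInd a i) * (udInd c i * udInd c i) * (udInd b i * udInd b i) := by ring
      _ = _ := by rw [ha, hc, hb]
  have hP : ∑ i, (1 - udInd c i) * (udInd (Pset k π) i * (udInd b i + bud n))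
      = (S2 b (Pset k π) - S3 c b (Pset k π)) + bud n * (S1 (Pset k π) - S2 c (Pset k π)) := by
    rw [S2, S3, S1, S2, ← Finset.sum_sub_distrib, ← Finset.sum_sub_distrib, Finset.mul_sum, ← Finset.sum_add_distrib]
    exact Finset.sum_congr rfl fun i _ => by ring
  have hC : ∑ i, udInd c i * ((1 - udInd (Pset k π) i) * (bud n - udInd b i))
      = bud n * (S1 c - S2 c (Pset k π)) - (S2 c b - S3 c b (Pset k π)) := by
    rw [S1, S2, S2, S3, ← Finset.sum_sub_distrib, ← Finset.sum_sub_distrib, Finset.mul_sum, ← Finset.sum_sub_distrib]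
    exact Finset.sum_congr rfl fun i _ => by ring
  rw [hY, hP, hC]; ring

/-- the block total in the regime `D_P ≥ 0`. -/
theorem blk_sum_pos (k k' : ℕ) (hD : ¬ DP b π k k' < 0) :
    ∑ x : BlkIx n, blkU a c k k' x * blkV b π k k' x
      = (DP b π k k' + (S2 c b - S3 c b (Pset k π)) + (S1 c - S2 a c - S2 c b + S3 a c b))
          * (DP b π k k' + (S2 c b - S3 c b (Pset k π)) + (S1 c - S2 a c - S2 c b + S3 a c b))
        + ((4 * n + 2 * S1 c + 2 * (S1 c - S2 a c)) * (S1 (Pset k π) - S2 c (Pset k π))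
            - 2 * (DP b π k k' + (S2 c b - S3 c b (Pset k π)) + (S1 c - S2 a c - S2 c b + S3 a c b))
              * (S2 b (Pset k π) - S3 c b (Pset k π)))
        + (S2 b (Pset k π) - S3 c b (Pset k π)) * (S2 b (Pset k π) - S3 c b (Pset k π))
        + (S1 c - S2 a c - S2 c b + S3 a c b)
        + (bud n - 4 * n - 2 * k - 2 * (k - k')) * (S1 (Pset k π) - S2 c (Pset k π))
        + bud n * (S1 c - S2 c (Pset k π)) := by
  simp only [Fintype.sum_sum_type, blkU, blkV, Sum.elim_inl, Sum.elim_inr, if_neg hD, mul_zero,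
    Finset.sum_const_zero, zero_add]
  have hdP : ∑ i, (1 - udInd c i) * udInd (Pset k π) i = S1 (Pset k π) - S2 c (Pset k π) := by
    rw [S1, S2, ← Finset.sum_sub_distrib]; exact Finset.sum_congr rfl fun i _ => by ring
  have hdm : ∑ i, (1 - udInd c i) * udInd (Pset k π) i * udInd b i = S2 b (Pset k π) - S3 c b (Pset k π) := by
    rw [S2, S3, ← Finset.sum_sub_distrib]; exact Finset.sum_congr rfl fun i _ => by ring
  have hZ := sum_rho_kap a c b π k k'
  -- Zsq
  have h1 : ∑ p : Rix n × Rix n, rho a c p.1 * rho a c p.2 * (kap b π k k' p.1 * kap b π k k' p.2)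
      = (∑ r, rho a c r * kap b π k k' r) * (∑ r, rho a c r * kap b π k k' r) := by
    rw [Fintype.sum_prod_type, Finset.sum_mul_sum]
    exact Finset.sum_congr rfl fun r _ => Finset.sum_congr rfl fun r' _ => by ring
  -- Dneg
  have h2 : ∑ p : Rix n × Fin n, rho a c p.1 * (1 - udInd c p.2) *
      (udInd (Pset k π) p.2 * (beta n p.1 - 2 * kap b π k k' p.1 * udInd b p.2))
      = (∑ r, rho a c r * beta n r) * (∑ i, (1 - udInd c i) * udInd (Pset k π) i)
        - 2 * ((∑ r, rho a c r * kap b π k k' r) * (∑ i, (1 - udInd c i) * udInd (Pset k π) i * udInd b i)) := by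
    rw [Fintype.sum_prod_type, Finset.sum_mul_sum, Finset.sum_mul_sum, Finset.mul_sum, ← Finset.sum_sub_distrib]
    refine Finset.sum_congr rfl fun r _ => ?_
    rw [Finset.mul_sum, ← Finset.sum_sub_distrib]
    exact Finset.sum_congr rfl fun i _ => by ring
  -- Dm2
  have h3 : ∑ p : Fin n × Fin n, (1 - udInd c p.1) * (1 - udInd c p.2) *
      (udInd b p.1 * udInd (Pset k π) p.1 * (udInd b p.2 * udInd (Pset k π) p.2))
      = (∑ i, (1 - udInd c i) * udInd (Pset k π) i * udInd b i)
        * (∑ i, (1 - udInd c i) * udInd (Pset k π) i * udInd b i) := by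
    rw [Fintype.sum_prod_type, Finset.sum_mul_sum]
    exact Finset.sum_congr rfl fun i _ => Finset.sum_congr rfl fun i' _ => by ring
  -- Tau
  have h4 : ∑ j, udInd c j * (1 - udInd a j) * (1 - udInd b j) = S1 c - S2 a c - S2 c b + S3 a c b := by
    rw [S1, S2, S2, S3, ← Finset.sum_sub_distrib, ← Finset.sum_sub_distrib, ← Finset.sum_add_distrib]
    exact Finset.sum_congr rfl fun i _ => by ring
  -- Left
  have h5 : ∑ i, (bud n - 4 * n - 2 * k - 2 * (k - k')) * (1 - udInd c i) * udInd (Pset k π) i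
      = (bud n - 4 * n - 2 * k - 2 * (k - k')) * (S1 (Pset k π) - S2 c (Pset k π)) := by
    rw [← hdP, Finset.mul_sum]; exact Finset.sum_congr rfl fun i _ => by ring
  -- Cbud
  have h6 : ∑ i, udInd c i * (bud n * (1 - udInd (Pset k π) i)) = bud n * (S1 c - S2 c (Pset k π)) := by
    rw [S1, S2, ← Finset.sum_sub_distrib, Finset.mul_sum]; exact Finset.sum_congr rfl fun i _ => by ring
  rw [h1, h2, h3, h4, h5, h6, hZ, sum_rho_beta, hdP, hdm]; ring

/-- the block contribution of the slot sum. -/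
theorem blk_sum :
    ∑ q : Fin (n + 1) × Fin (n + 1) × BlkIx n,
        rowU a c (Sum.inr (Sum.inr (Sum.inr q))) * colV b π (Sum.inr (Sum.inr (Sum.inr q)))
      = ∑ x : BlkIx n, blkU a c c.card (a ∩ c).card x * blkV b π c.card (a ∩ c).card x := by
  have hc : c.card ≤ n := (Finset.card_le_univ c).trans (by simp)
  have hac : (a ∩ c).card ≤ n := (Finset.card_le_univ _).trans (by simp)
  rw [Fintype.sum_prod_type]
  simp only [Fintype.sum_prod_type, rowU, colV, Sum.elim_inr]
  have : ∀ k k' : Fin (n + 1), ∑ x : BlkIx n, sel a c k k' * blkU a c k k' x * blkV b π k k' x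
      = sel a c k k' * ∑ x : BlkIx n, blkU a c k k' x * blkV b π k k' x := by
    intro k k'; rw [Finset.mul_sum]; exact Finset.sum_congr rfl fun x _ => by ring
  simp only [this]
  rw [sum_sel a c hc hac (fun k k' => ∑ x : BlkIx n, blkU a c k k' x * blkV b π k k' x)]

end families

/-! ## §4 The identity -/

/-- **the vertex-row identity**: the augmented slack of the located `{0,1}`-tilted row `(a, c)` against the column
`(b, π)` of `COR(n) + Q^Π_λ` equals `Σ_s rowU (a,c) s · colV (b,π) s`. -/
theorem vertex_identity (a c b : Finset (Fin n)) (π : Equiv.Perm (Fin n)) :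
    (1 - ((a ∩ b).card : ℝ)) ^ 2 + ∑ i, (max (udInd c i - udInd a i) 0 - (udInd c i - udInd a i) * udInd b i)
      + lam n * inv c π = ∑ s, rowU a c s * colV b π s := by
  have hc : c.card ≤ n := (Finset.card_le_univ c).trans (by simp)
  -- left-hand side in atoms
  have hL : ∑ i, (max (udInd c i - udInd a i) 0 - (udInd c i - udInd a i) * udInd b i)
      = (S1 c - S2 a c) - (S2 c b - S2 a b) := by
    simp only [max_sub_eq]
    rw [S1, S2, S2, S2, ← Finset.sum_sub_distrib, ← Finset.sum_sub_distrib, ← Finset.sum_sub_distrib]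
    exact Finset.sum_congr rfl fun i _ => by ring
  rw [← udInd_inter a b, hL]
  -- right-hand side by families
  simp only [Fintype.sum_sum_type]
  rw [pairB_sum, e1_sum, e2_sum, blk_sum]
  -- relations
  have r1 : S1 c = c.card := sum_udInd_univ c
  have r2 : S2 a c = ((a ∩ c).card : ℝ) := udInd_inter a c
  have r3 : S1 (Pset c.card π) = c.card := S1_Pset hc π
  have hlam : lam n = 2 * bud n := by unfold lam bud; ring
  by_cases hD : DP b π c.card (a ∩ c).card < 0
  · rw [blk_sum_neg a c b π _ _ hD, r1, r2, r3, hlam]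
    simp only [DP, S2, S3]
    ring
  · rw [blk_sum_pos a c b π _ _ hD, r1, r2, r3, hlam]
    simp only [DP, S2, S3]
    ring

end

end Summit.ValiantsHypothesis.Theorems.NNDivisionHardNegative.LocatedPencil
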